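import Summits.BirchSwinnertonDyer.BirchSwinnertonDyer.Theorems.SignedBaseChangeAnticyclotomicEisensteinDivisibilitySpecializationHerbrand
import Literature.NumberTheory.EllipticCurves.TwoVariableSelmerDual
import Literature.NumberTheory.EllipticCurves.YanZhu2026.GreenbergMainTheorems
import Literature.NumberTheory.EllipticCurves.Castella2018.AnticyclotomicSelmerDual
import HarnessLib

/-!
# Stub S2 of line `bdpline` (crux `AnticyclotomicEisensteinDivisibility`, stmt-BirchSwinnertonDyer-20727)
# reduced to its arithmetic inputs BY NAME: control + `X_Gr₂[T₁] = 0` + a torsion witness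

Helper file (--supports stmt-BirchSwinnertonDyer-20727), fourth of the `…Specialization*` files of the
lead-prover seat (sbc-p1 g7). Stub S2 (`stub_specializationSS` of the registered skeleton, sha16
24aed5004cf12400) asks, at a good supersingular prime, for the containment
`π(ch_{Λ₂}(X_Gr₂)·Λ₂^ur) ⊆ ch_{Λ₁}(X_Gr(E/K_∞⁻))·𝒪⟦T⟧` (`π = T₁ ↦ 0`, read along a structure map
`J : ℤ_p → 𝒪 = 𝒪_{ℂ_p}`). With the specialisation formula PROVED
(`SignedBaseChangeAcDivSpecialization.TwoVar.map_constantCoeff_charIdeal_eq`), this file proves the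
MODULE-THEORETIC REDUCTION, for the tree's CONSTRUCTED carriers and for any `Λ₂`-module `X` and
`Λ₁`-module `Y`:

* `map_toUnr₂_map_constantCoeff_le` — if `X` is finitely generated over `Λ₂ = ℤ_p⟦T₂⟧⟦T₁⟧`, killed by
  some `s` with `s(0) ≠ 0` (⟸ torsion inputs, S0), `T₁` is injective on `X` (⟸ no non-zero pseudo-null
  submodule, Greenberg 2016 Prop. 4.1.1), and there is a SURJECTIVE `Λ₁`-linear map
  `X/T₁X → Y` for the constants `Λ₁`-structure on `X/T₁X` (⟸ control, wi-82197), then for every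
  `J : ℤ_p →+* 𝒪`: `((ch_{Λ₂} X).map (toUnr₂ J)).map constantCoeff ≤ (ch_{Λ₁} Y).map (PowerSeries.map J)`;
* `xGr₂_specialization_le_of_control` — the same for `X = X_Gr₂ = WeierstrassCurve.XGr₂ …` and
  `Y = X_ac = Castella2018.AcSelmer.XAc …`, i.e. the conclusion of `stub_specializationSS` from the three
  named inputs; `exists_constantCoeff_ne_zero_of_isTorsion` / `isTorsion_of_exists_constantCoeff_ne_zero`
  convert the torsion input (f.g. + `X/T₁X` torsion over `Λ₁` ⟹ killing `s` with `s(0) ≠ 0` ⟹ `X` torsion,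
  i.e. stub S0).

Pure algebra over constructed modules; nothing about elliptic curves is asserted (the three inputs are
hypotheses). The `Λ₁ = ℤ_p⟦T⟧`-structure on `X/T₁X` is the restriction along the constants
`PowerSeries.C : Λ₁ → Λ₂` (`T ↦ T₂ = C T`, which acts on `X_Gr₂` as `γ₂ − 1`, matching the `Λ`-structure
of `X_ac` through the anticyclotomic generator `γ₂`), written `letI := Module.compHom _ PowerSeries.C`.
-/

-- D-0017: single-problem summit, the namespace repeats the problem name by design.
set_option linter.dupNamespace false
set_option autoImplicit false

noncomputable section

open Function
open scoped Pointwise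

namespace Summit.BirchSwinnertonDyer.BirchSwinnertonDyer.Theorems.SignedBaseChangeAcDivSpecialization

namespace S2

open Literature.NumberTheory.EllipticCurves Literature.NumberTheory.EllipticCurves.Module LocalLength
  PowerSeriesSpecialization

/-- `constantCoeff ∘ toUnr₂ J = (map J) ∘ constantCoeff`: extending scalars coefficientwise commutes with
`T₁ ↦ 0`. [folklore] -/
theorem constantCoeff_comp_toUnr₂ (p : ℕ) [Fact p.Prime] (J : ℤ_[p] →+* PadicComplexInt p) :
    (PowerSeries.constantCoeff (R := PowerSeries (PadicComplexInt p))).comp (IwasawaAlgebra₂.toUnr₂ p J) =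
      (PowerSeries.map J).comp (PowerSeries.constantCoeff (R := IwasawaAlgebra p)) := by
  refine RingHom.ext fun φ => ?_
  show PowerSeries.constantCoeff (PowerSeries.map (PowerSeries.map J) φ) =
    PowerSeries.map J (PowerSeries.constantCoeff φ)
  rw [← PowerSeries.coeff_zero_eq_constantCoeff_apply, PowerSeries.coeff_map,
    PowerSeries.coeff_zero_eq_constantCoeff_apply]

/-- From "`X` finitely generated over `Λ₂` with `X/T₁X` torsion over `Λ₁` (constants structure)" to a
killing element `s ∈ Λ₂` with `s(0) ≠ 0` (determinant trick; then `X` is `Λ₂`-torsion and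
`X_{(T₁)} = 0`). The form in which the torsion input (S0) of line `bdpline` is consumed. [folklore] -/
theorem exists_constantCoeff_ne_zero_of_isTorsion (p : ℕ) [Fact p.Prime] (X : Type*) [AddCommGroup X]
    [Module (PowerSeries (IwasawaAlgebra p)) X] [Module.Finite (PowerSeries (IwasawaAlgebra p)) X]
    (hq : letI : Module (IwasawaAlgebra p)
              (QuotSMulTop (PowerSeries.X : PowerSeries (IwasawaAlgebra p)) X) :=
            Module.compHom _ (PowerSeries.C (R := IwasawaAlgebra p))
      Module.IsTorsion (IwasawaAlgebra p)
        (QuotSMulTop (PowerSeries.X : PowerSeries (IwasawaAlgebra p)) X)) :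
    ∃ s : PowerSeries (IwasawaAlgebra p), PowerSeries.constantCoeff s ≠ 0 ∧ ∀ x : X, s • x = 0 := by
  let alg : Algebra (IwasawaAlgebra p) (PowerSeries (IwasawaAlgebra p)) :=
    @MvPowerSeries.instAlgebra Unit (IwasawaAlgebra p) (IwasawaAlgebra p) _ _ (Algebra.id _)
  letI : Module (IwasawaAlgebra p) X := Module.compHom X (PowerSeries.C (R := IwasawaAlgebra p))
  have hIST : @IsScalarTower (IwasawaAlgebra p) (PowerSeries (IwasawaAlgebra p)) X alg.toSMul
      inferInstance inferInstance :=
    @IsScalarTower.mk _ _ _ alg.toSMul _ _ fun a r m => by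
      rw [@Algebra.smul_def _ _ _ _ alg a r, mul_smul]
      rfl
  refine @exists_constantCoeff_ne_zero_smul_eq_zero (IwasawaAlgebra p) _ _ X _ _ _ _ hIST ?_
  rw [Submodule.ideal_span_singleton_smul]
  exact hq

/-- A killing element with nonzero constant term makes `X` a torsion `Λ₂`-module (S0 of line
`bdpline` from the S2 inputs). [folklore] -/
theorem isTorsion_of_exists_constantCoeff_ne_zero (p : ℕ) [Fact p.Prime] (X : Type*) [AddCommGroup X]
    [Module (PowerSeries (IwasawaAlgebra p)) X]
    (hs : ∃ s : PowerSeries (IwasawaAlgebra p), PowerSeries.constantCoeff s ≠ 0 ∧ ∀ x : X, s • x = 0) :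
    Module.IsTorsion (PowerSeries (IwasawaAlgebra p)) X := by
  obtain ⟨s, hs0, hs⟩ := hs
  have hsne : s ≠ 0 := fun h => hs0 (by rw [h, map_zero])
  exact fun x => ⟨⟨s, mem_nonZeroDivisors_of_ne_zero hsne⟩, hs x⟩

/-- **Module-theoretic reduction of stub S2.** Let `X` be a finitely generated `Λ₂`-module killed by some
`s` with `s(0) ≠ 0`, on which `T₁` is injective, and `f : X/T₁X → Y` a surjective `Λ₁`-linear map onto a
`Λ₁`-module `Y` (the `Λ₁`-structure on `X/T₁X` restricted along the constants). Then
`π(ch_{Λ₂} X · Λ^ur) ⊆ ch_{Λ₁}(Y) · 𝒪⟦T⟧` for every structure map `J`: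
`π(ch_{Λ₂} X) = ch_{Λ₁}(X/T₁X) = ch(ker f) · ch(Y) ⊆ ch(Y)` (specialisation formula + multiplicativity),
then extend scalars. [folklore] -/
theorem map_toUnr₂_map_constantCoeff_le (p : ℕ) [Fact p.Prime] (X : Type*) [AddCommGroup X]
    [Module (PowerSeries (IwasawaAlgebra p)) X] [Module.Finite (PowerSeries (IwasawaAlgebra p)) X]
    (Y : Type*) [AddCommGroup Y] [Module (IwasawaAlgebra p) Y]
    (hs : ∃ s : PowerSeries (IwasawaAlgebra p),
      PowerSeries.constantCoeff s ≠ 0 ∧ ∀ x : X, s • x = 0)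
    (hX : ∀ x : X, (PowerSeries.X : PowerSeries (IwasawaAlgebra p)) • x = 0 → x = 0)
    (f : letI : Module (IwasawaAlgebra p)
              (QuotSMulTop (PowerSeries.X : PowerSeries (IwasawaAlgebra p)) X) :=
            Module.compHom _ (PowerSeries.C (R := IwasawaAlgebra p))
      QuotSMulTop (PowerSeries.X : PowerSeries (IwasawaAlgebra p)) X →ₗ[IwasawaAlgebra p] Y)
    (hf : Surjective f) (J : ℤ_[p] →+* PadicComplexInt p) :
    ((charIdeal (PowerSeries (IwasawaAlgebra p)) X).map (IwasawaAlgebra₂.toUnr₂ p J)).map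
        (PowerSeries.constantCoeff (R := PowerSeries (PadicComplexInt p))) ≤
      (charIdeal (IwasawaAlgebra p) Y).map (PowerSeries.map J) := by
  rw [Ideal.map_map, constantCoeff_comp_toUnr₂, ← Ideal.map_map]
  refine Ideal.map_mono ?_
  rw [TwoVar.map_constantCoeff_charIdeal_eq p X hs hX]
  -- `X/T₁X` is finitely generated torsion over `Λ₁` (constants structure)
  let alg : Algebra (IwasawaAlgebra p) (PowerSeries (IwasawaAlgebra p)) :=
    @MvPowerSeries.instAlgebra Unit (IwasawaAlgebra p) (IwasawaAlgebra p) _ _ (Algebra.id _)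
  letI : Module (IwasawaAlgebra p) X := Module.compHom X (PowerSeries.C (R := IwasawaAlgebra p))
  have hIST : @IsScalarTower (IwasawaAlgebra p) (PowerSeries (IwasawaAlgebra p)) X alg.toSMul
      inferInstance inferInstance :=
    @IsScalarTower.mk _ _ _ alg.toSMul _ _ fun a r m => by
      rw [@Algebra.smul_def _ _ _ _ alg a r, mul_smul]
      rfl
  obtain ⟨s, hs0, hs⟩ := hs
  haveI : Module.Finite (IwasawaAlgebra p)
      (QuotSMulTop (PowerSeries.X : PowerSeries (IwasawaAlgebra p)) X) :=
    @moduleFinite_quotSMulTop (IwasawaAlgebra p) _ X _ _ _ hIST _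
  have h1 := (@isTorsionBy_constantCoeff (IwasawaAlgebra p) _ X _ _ _ hIST s hs).1
  have htors : Module.IsTorsion (IwasawaAlgebra p)
      (QuotSMulTop (PowerSeries.X : PowerSeries (IwasawaAlgebra p)) X) := fun q =>
    ⟨⟨PowerSeries.constantCoeff s, mem_nonZeroDivisors_of_ne_zero hs0⟩, @h1 q⟩
  rw [charIdeal_eq_mul_of_exact htors (LinearMap.ker f).subtype f (Submodule.subtype_injective _) hf
    (LinearMap.exact_subtype_ker_map f)]
  exact Ideal.mul_le_left

/-- **Stub S2 of line `bdpline` from its three named inputs**, for the constructed carriers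
`X_Gr₂ = X_Gr(E/K̃_∞)` (`WeierstrassCurve.XGr₂`, a `Λ₂ = ℤ_p⟦T₂⟧⟦T₁⟧`-module) and
`X_ac = X_Gr(E/K_∞⁻)` (`Castella2018.AcSelmer.XAc … ∅ γ₂`, a `Λ₁ = ℤ_p⟦T⟧`-module through `γ₂`):
finite generation + a killing element `s` with `s(0) ≠ 0` (S0 / torsion), `X_Gr₂[T₁] = 0` (no non-zero
pseudo-null submodule, Greenberg 2016 Prop. 4.1.1) and a surjective `Λ₁`-linear control map
`X_Gr₂/T₁ ↠ X_ac` (wi-82197) imply `π(ch(X_Gr₂)·Λ^ur) ⊆ ch(X_ac)·𝒪⟦T⟧` — the conclusion of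
`stub_specializationSS`. [folklore] -/
theorem xGr₂_specialization_le_of_control {K : Type} [Field K] [NumberField K] (W : WeierstrassCurve K)
    (p : ℕ) [Fact p.Prime] (κ₁ κ₂ : ZpExtension K p)
    (vbar : IsDedekindDomain.HeightOneSpectrum (NumberField.RingOfIntegers K))
    (γ₁ γ₂ : Field.absoluteGaloisGroup K) [Fact (ZpExtension.IsTopGeneratorPair κ₁ κ₂ γ₁ γ₂)]
    [Fact (κ₂.IsTopGenerator γ₂)]
    [Module.Finite (IwasawaAlgebra₂ p) (W.XGr₂ p κ₁ κ₂ vbar γ₁ γ₂)]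
    (hs : ∃ s : IwasawaAlgebra₂ p,
      PowerSeries.constantCoeff s ≠ 0 ∧ ∀ x : W.XGr₂ p κ₁ κ₂ vbar γ₁ γ₂, s • x = 0)
    (hX : ∀ x : W.XGr₂ p κ₁ κ₂ vbar γ₁ γ₂, (PowerSeries.X : IwasawaAlgebra₂ p) • x = 0 → x = 0)
    (f : letI : Module (IwasawaAlgebra p)
              (QuotSMulTop (PowerSeries.X : IwasawaAlgebra₂ p) (W.XGr₂ p κ₁ κ₂ vbar γ₁ γ₂)) :=
            Module.compHom _ (PowerSeries.C (R := IwasawaAlgebra p))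
      QuotSMulTop (PowerSeries.X : IwasawaAlgebra₂ p) (W.XGr₂ p κ₁ κ₂ vbar γ₁ γ₂) →ₗ[IwasawaAlgebra p]
        Castella2018.AcSelmer.XAc W p κ₂ vbar ∅ γ₂)
    (hf : Surjective f) (J : ℤ_[p] →+* PadicComplexInt p) :
    ((WeierstrassCurve.XGr₂.charIdeal W p κ₁ κ₂ vbar γ₁ γ₂).map (IwasawaAlgebra₂.toUnr₂ p J)).map
        (PowerSeries.constantCoeff (R := PowerSeries (PadicComplexInt p))) ≤
      (Castella2018.AcSelmer.XAc.charIdeal W p κ₂ vbar ∅ γ₂).map (PowerSeries.map J) :=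
  map_toUnr₂_map_constantCoeff_le p (W.XGr₂ p κ₁ κ₂ vbar γ₁ γ₂) (Castella2018.AcSelmer.XAc W p κ₂ vbar ∅ γ₂)
    hs hX f hf J

end S2

end Summit.BirchSwinnertonDyer.BirchSwinnertonDyer.Theorems.SignedBaseChangeAcDivSpecialization

end
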